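import Summits.ValiantsHypothesis.ValiantsHypothesis.Theorems.KPlusLogSqLawTridiagonalSplitting

/-!
# Route «KPlusLogSqLaw», crux `WeakLifting` (stmt-ValiantsHypothesis-19561) — the TRIDIAGONAL SECTOR
# (part 2 of 2): `stub_tridiagonalSectorB` ⟺ its restriction to IRREDUCIBLE chains; coupling-free and bounded-coupling pencils obey it at all formats

HONEST FRAMING.  Helper theorems (`--supports stmt-ValiantsHypothesis-19561 --as helper`) about the two WITNESS-PLAN stubs
`stub_tridiagonalSectorB` / `stub_tridiagonalSectorBDiag` registered in `Cruxes/WeakLifting/Lines/birth.lean` (re-cut v2): real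
symmetric lacunary pencils `∑ l, X^(d l) • S l` of format `(m, K)` whose coefficients `S l` are TRIDIAGONAL.  Nothing here proves either
stub in the window `c·log₂ m < K < m/2^c`; nothing bears on `WeakLifting`, on B (`KPlusLogSqLaw`), on `TropicalB` (stmt-19771), on
`MatrixDescartes` (stmt-18050) or on VP ≠ VNP.  Seat val-sym-lift-p4 (g3), 2026-08-26.  Uses part 1 (`…TridiagonalSplitting`: block
factorisation at an absent link, sub-additivity of distinct real zeros, per-block Descartes bound).

WHAT IS PROVED (all formats `(m, K)`, explicit constants; «link `i`» = the entry pair `(i, i+1) / (i+1, i)`; a link is ABSENT when no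
class is present on it, i.e. `S l i (i+1) = 0` for every `l`).
1. COUPLING-FREE SUB-SECTOR (`card_roots_le_of_diagonal`, `sectorB_of_diagonal`).  If every `S l` is diagonal the determinant is a product
   of `m` polynomials with `≤ K` monomials, so it has `≤ m·(2K − 1)` distinct real zeros (`Census.realRootLawAt_descartes` at `m = 1`), and
   the stub's inequality holds with `C = 2` — in the window as well.
2. BOUNDED COUPLING LENGTH (`card_roots_le_of_shortChains`, `sectorB_of_shortChains`).  If among any `r` consecutive links one is absent
   (every irreducible block has size `≤ r`), the count is `≤ m · 2^(r + K)` (Descartes block by block), hence `≤ 2^((r+2)(K + ⌊log₂ m⌋²))`: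
   the stub holds on every sub-sector of bounded chain length, uniformly in `(m, K)`.
3. REDUCTION TO IRREDUCIBLE CHAINS (`tridiagonalSectorB_of_irreducible`, `tridiagonalSectorB_iff_irreducible`).  The stub's statement
   VERBATIM is equivalent to its restriction to IRREDUCIBLE families (a class present on every link; for `x > 0` off the zeros of the link
   polynomials the matrix is then a Jacobi matrix): constant `C` for irreducible families gives `C + 2` for all (`m ≤ 2^(2⌊log₂ m⌋²)`).
(Off the window — `K ≤ c·⌊log₂ m⌋` or `m ≤ 2^c·K` — the stub's inequality holds with `C = 2^c + 1` for ALL symmetric pencils by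
`Theorems.KPlusLogSqLaw.kPlusLogSqLaw_offWindow`, p440118; not restated here.)

READING (where `stub_tridiagonalSectorB` lives).  The TROPICAL side of the sector is POLYNOMIAL in the kernel (`IntervalOpt.chain_le_banded`,
bandwidth `u = 1`: `n + 1 ≤ (mK+1)(2m)^5`, val-sym-trop-p5), and by 1–2 the coupling-free / bounded-coupling real sub-sectors are linear in `m`
times a function of `(r, K)`.  So the stub's content is the real-zero EXCESS CREATED BY COUPLING COMPOUNDING ALONG LONG IRREDUCIBLE CHAINS (3) in
the window: Descartes allows `C(m+K−1, m) − 1` zeros, i.e. about `log₂(e·m/K)` bits per class there; the stub asks `O(1)` bits per class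
(plus `⌊log₂ m⌋²`); block sums give `O(log₂(mK))` bits in total.  The first coupled atom is the `2 × 2` block `a₁a₂ − b²` — the cell's door-A
column `(2, K)` (9, 14 distinct positive zeros at `K = 4, 5`: Descartes-extremal) — so ONE link does lift `2K` to `≈ K²/2`; whether coupling
COMPOUNDS along a chain (zeros multiplying rather than adding from block to block) is what a proof or a refutation of the stub must decide.
[folklore: block factorisation of tridiagonal determinants; Descartes' rule of signs]
-/

set_option linter.dupNamespace false
set_option autoImplicit false

namespace Summit.ValiantsHypothesis.ValiantsHypothesis.Theorems.KPlusLogSqLaw.TridiagonalSplitting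

open Summit.ValiantsHypothesis.ValiantsHypothesis.Theorems.LacunarySymmetroidMatrixDescartes
open scoped BigOperators
open Polynomial

variable {m K : ℕ}

/-! ## 1. The coupling-free sub-sector (all coefficients diagonal) -/

/-- a polynomial supported on `≤ K` prescribed exponents has at most `2K − 1` distinct real zeros: the `1 × 1` case of the census row
`Census.realRootLawAt_descartes`. [folklore] -/
theorem card_roots_kNomial_le (d : Fin K → ℕ) (c : Fin K → ℝ) :
    (∑ l, C (c l) * X ^ d l).roots.toFinset.card ≤ 2 * K - 1 := by
  classical
  rcases Nat.eq_zero_or_pos K with hK | hK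
  · subst hK
    simp
  -- the `1 × 1` symmetric pencil with entries `c l`
  have h := Census.realRootLawAt_descartes 1 K hK d (fun l => Matrix.of fun _ _ => c l)
    (fun l => by ext i j; simp [Matrix.transpose_apply])
  have hdet : Matrix.det (∑ l, ((X : ℝ[X]) ^ d l) • ((fun l => Matrix.of fun (_ _ : Fin 1) => c l) l).map C) =
      ∑ l, C (c l) * X ^ d l := by
    rw [Matrix.det_fin_one, pencil_apply]
    rfl
  rw [hdet] at h
  have hch : Nat.choose (1 + K - 1) 1 = K := by
    rw [show 1 + K - 1 = K by omega, Nat.choose_one_right]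
  rw [hch] at h
  exact h

/-- **COUPLING-FREE PENCILS ARE ADDITIVE.**  If every coefficient matrix is diagonal, the determinant is the product of the `m` diagonal
`K`-nomials, so the pencil has at most `m·(2K − 1)` distinct real zeros — at every format. [folklore] -/
theorem card_roots_le_of_diagonal (d : Fin K → ℕ) (S : Fin K → Matrix (Fin m) (Fin m) ℝ)
    (hdiag : ∀ l (i j : Fin m), i ≠ j → S l i j = 0) :
    (Matrix.det (∑ l, ((X : ℝ[X]) ^ d l) • (S l).map C)).roots.toFinset.card ≤ m * (2 * K - 1) := by
  classical
  have hup : (∑ l, ((X : ℝ[X]) ^ d l) • (S l).map C).BlockTriangular id := by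
    intro i j hij
    exact pencil_apply_eq_zero d S fun l => hdiag l i j (ne_of_gt hij)
  rw [Matrix.det_of_upperTriangular hup]
  calc _ ≤ ∑ i : Fin m, ((∑ l, ((X : ℝ[X]) ^ d l) • (S l).map C) i i).roots.toFinset.card :=
        card_roots_toFinset_prod_le _ _
    _ ≤ ∑ _i : Fin m, (2 * K - 1) := Finset.sum_le_sum fun i _ => by
        rw [pencil_apply]
        exact card_roots_kNomial_le d fun l => S l i i
    _ = m * (2 * K - 1) := by simp

/-- **`stub_tridiagonalSectorB` ON THE COUPLING-FREE SUB-SECTOR, `C = 2`, ALL FORMATS** (window included): diagonal coefficient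
matrices give at most `m(2K−1) ≤ 2^(2(K + ⌊log₂ m⌋²))` distinct real zeros. [folklore] -/
theorem sectorB_of_diagonal (d : Fin K → ℕ) (S : Fin K → Matrix (Fin m) (Fin m) ℝ)
    (hdiag : ∀ l (i j : Fin m), i ≠ j → S l i j = 0) :
    (Matrix.det (∑ l, ((X : ℝ[X]) ^ d l) • (S l).map C)).roots.toFinset.card ≤ 2 ^ (2 * (K + Nat.log 2 m ^ 2)) := by
  refine (card_roots_le_of_diagonal d S hdiag).trans ?_
  have h1 : m ≤ 2 ^ (2 * Nat.log 2 m ^ 2) := self_le_two_pow_two_mul_log_sq m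
  have h2 : 2 * K - 1 ≤ 2 ^ (2 * K) := by
    have : 2 * K < 2 ^ (2 * K) := Nat.lt_two_pow_self
    omega
  calc m * (2 * K - 1) ≤ 2 ^ (2 * Nat.log 2 m ^ 2) * 2 ^ (2 * K) := Nat.mul_le_mul h1 h2
    _ = 2 ^ (2 * (K + Nat.log 2 m ^ 2)) := by rw [← pow_add]; ring_nf


/-! ## 2. Bounded coupling length: an absent link among any `r` consecutive links -/

/-- **BOUNDED COUPLING LENGTH IS ADDITIVE.**  If `S` is a symmetric tridiagonal family in which, among any `r` consecutive links
`i, i+1, …, i+r−1` (all inside the matrix), at least one is absent, then the pencil has at most `m · 2^(r + K)` distinct real zeros, at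
every format: split at the first absent link, bound the leading block (size `≤ r`) by Descartes, recurse on the trailing block. [folklore] -/
theorem card_roots_le_of_shortChains (r : ℕ) (d : Fin K → ℕ) :
    ∀ (m : ℕ) (S : Fin K → Matrix (Fin m) (Fin m) ℝ), (∀ l, (S l).IsSymm) →
      (∀ l (i j : Fin m), (i : ℕ) + 1 < j ∨ (j : ℕ) + 1 < i → S l i j = 0) →
      (∀ i : Fin m, (i : ℕ) + r < m → ∃ j : Fin m, (i : ℕ) ≤ j ∧ (j : ℕ) < i + r ∧
          ∀ l (j' : Fin m), (j' : ℕ) = j + 1 → S l j j' = 0) →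
      (Matrix.det (∑ l, ((X : ℝ[X]) ^ d l) • (S l).map C)).roots.toFinset.card ≤ m * 2 ^ (r + K) := by
  intro m
  refine Nat.strong_induction_on m ?_
  intro m ih S hS htri hshort
  rcases Nat.eq_zero_or_pos m with hm0 | hm0
  · rw [card_roots_eq_zero_of_size_zero hm0]
    exact Nat.zero_le _
  rcases Nat.lt_or_ge r m with hmr | hmr
  swap
  · -- a single short block: Descartes
    calc _ ≤ 2 ^ (m + K) := card_roots_le_two_pow d S hS
      _ ≤ 2 ^ (r + K) := Nat.pow_le_pow_right two_pos (by omega)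
      _ ≤ m * 2 ^ (r + K) := Nat.le_mul_of_pos_left _ hm0
  · -- split at the first absent link `j`, `j < r`
    obtain ⟨j, -, hjr, habs⟩ := hshort ⟨0, hm0⟩ (by simpa using hmr)
    simp only [zero_add] at hjr
    have ht : (j : ℕ) + 1 ≤ m := by omega
    have hlink : ∀ l (i j₂ : Fin m), (j₂ : ℕ) + 1 = (j : ℕ) + 1 → (i : ℕ) = (j : ℕ) + 1 → S l i j₂ = 0 := by
      intro l i j₂ hj₂ hi
      have e₂ : j₂ = j := Fin.ext (by omega)
      rw [e₂, (hS l).apply j i]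
      exact habs l i hi
    have hcut := cut_of_absentLink S htri hlink
    refine (card_roots_split d S ht hcut).trans ?_
    have htop := card_roots_le_two_pow d _ (symm_top hS ht)
    have hbot := ih (m - ((j : ℕ) + 1)) (by omega) _ (symm_bot hS ht) (tridiagonal_bot htri ht) ?_
    · have h1 : 2 ^ ((j : ℕ) + 1 + K) ≤ ((j : ℕ) + 1) * 2 ^ (r + K) :=
        (Nat.pow_le_pow_right two_pos (by omega)).trans (Nat.le_mul_of_pos_left _ (Nat.succ_pos _))
      have h2 : ((j : ℕ) + 1) * 2 ^ (r + K) + (m - ((j : ℕ) + 1)) * 2 ^ (r + K) = m * 2 ^ (r + K) := by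
        rw [← Nat.add_mul, Nat.add_sub_of_le ht]
      calc _ ≤ ((j : ℕ) + 1) * 2 ^ (r + K) + (m - ((j : ℕ) + 1)) * 2 ^ (r + K) := Nat.add_le_add (htop.trans h1) hbot
        _ = m * 2 ^ (r + K) := h2
    · -- the trailing block inherits the short-chain hypothesis (indices shifted by `t = j + 1`)
      intro i hi
      obtain ⟨j₀, hj₀i, hj₀r, habs₀⟩ := hshort (Fin.cast (Nat.add_sub_of_le ht) (Fin.natAdd ((j : ℕ) + 1) i))
        (by simp only [Fin.val_cast, Fin.val_natAdd]; omega)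
      simp only [Fin.val_cast, Fin.val_natAdd] at hj₀i hj₀r
      refine ⟨⟨(j₀ : ℕ) - ((j : ℕ) + 1), by omega⟩, by simp only; omega, by simp only; omega, ?_⟩
      intro l j' hj'
      simp only at hj'
      rw [Matrix.submatrix_apply]
      have e₀ : (Fin.cast (Nat.add_sub_of_le ht) (Fin.natAdd ((j : ℕ) + 1) ⟨(j₀ : ℕ) - ((j : ℕ) + 1), by omega⟩) : Fin m) = j₀ :=
        Fin.ext (by simp only [Fin.val_cast, Fin.val_natAdd]; omega)
      rw [e₀]
      exact habs₀ l _ (by simp only [Fin.val_cast, Fin.val_natAdd]; omega)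

/-- **`stub_tridiagonalSectorB` ON EVERY SUB-SECTOR OF BOUNDED COUPLING LENGTH, `C = r + 2`, ALL FORMATS.** [folklore] -/
theorem sectorB_of_shortChains (r m K : ℕ) (d : Fin K → ℕ) (S : Fin K → Matrix (Fin m) (Fin m) ℝ)
    (hS : ∀ l, (S l).IsSymm) (htri : ∀ l (i j : Fin m), (i : ℕ) + 1 < j ∨ (j : ℕ) + 1 < i → S l i j = 0)
    (hshort : ∀ i : Fin m, (i : ℕ) + r < m → ∃ j : Fin m, (i : ℕ) ≤ j ∧ (j : ℕ) < i + r ∧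
      ∀ l (j' : Fin m), (j' : ℕ) = j + 1 → S l j j' = 0) :
    (Matrix.det (∑ l, ((Polynomial.X : Polynomial ℝ) ^ d l) • (S l).map Polynomial.C)).roots.toFinset.card ≤
      2 ^ ((r + 2) * (K + Nat.log 2 m ^ 2)) := by
  rcases Nat.eq_zero_or_pos K with hK | hK
  · rw [card_roots_eq_zero_of_noClass hK]
    exact Nat.zero_le _
  refine (card_roots_le_of_shortChains r d m S hS htri hshort).trans ?_
  have h1 : m ≤ 2 ^ (2 * Nat.log 2 m ^ 2) := self_le_two_pow_two_mul_log_sq m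
  have hrK : r ≤ r * K := Nat.le_mul_of_pos_right r hK
  have hexp : 2 * Nat.log 2 m ^ 2 + (r + K) ≤ (r + 2) * (K + Nat.log 2 m ^ 2) := by
    have e : (r + 2) * (K + Nat.log 2 m ^ 2) = r * K + r * Nat.log 2 m ^ 2 + 2 * K + 2 * Nat.log 2 m ^ 2 := by ring
    rw [e]
    have : 0 ≤ r * Nat.log 2 m ^ 2 := Nat.zero_le _
    omega
  calc m * 2 ^ (r + K) ≤ 2 ^ (2 * Nat.log 2 m ^ 2) * 2 ^ (r + K) := Nat.mul_le_mul_right _ h1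
    _ = 2 ^ (2 * Nat.log 2 m ^ 2 + (r + K)) := (pow_add _ _ _).symm
    _ ≤ 2 ^ ((r + 2) * (K + Nat.log 2 m ^ 2)) := Nat.pow_le_pow_right two_pos hexp

/-! ## 3. Reduction of `stub_tridiagonalSectorB` to IRREDUCIBLE chains -/

/-- **IRREDUCIBLE BLOCKS ADD UP.**  If every IRREDUCIBLE symmetric tridiagonal family (a class present on every link) of every size `n`
obeys the sector bound `2^(C₀ (K + ⌊log₂ n⌋²))` (exponents `d` fixed), then every symmetric tridiagonal family of size `n` has at most
`n · 2^(C₀ (K + ⌊log₂ n⌋²))` distinct real zeros: split at an absent link and recurse on both blocks. [folklore] -/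
theorem card_roots_le_mul_of_irreducible (C₀ : ℕ) (d : Fin K → ℕ)
    (hirr : ∀ (n : ℕ) (S : Fin K → Matrix (Fin n) (Fin n) ℝ), (∀ l, (S l).IsSymm) →
      (∀ l (i j : Fin n), (i : ℕ) + 1 < j ∨ (j : ℕ) + 1 < i → S l i j = 0) →
      (∀ i j : Fin n, (j : ℕ) = i + 1 → ∃ l, S l i j ≠ 0) →
      (Matrix.det (∑ l, ((X : ℝ[X]) ^ d l) • (S l).map C)).roots.toFinset.card ≤ 2 ^ (C₀ * (K + Nat.log 2 n ^ 2))) :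
    ∀ (n : ℕ) (S : Fin K → Matrix (Fin n) (Fin n) ℝ), (∀ l, (S l).IsSymm) →
      (∀ l (i j : Fin n), (i : ℕ) + 1 < j ∨ (j : ℕ) + 1 < i → S l i j = 0) →
      (Matrix.det (∑ l, ((X : ℝ[X]) ^ d l) • (S l).map C)).roots.toFinset.card ≤ n * 2 ^ (C₀ * (K + Nat.log 2 n ^ 2)) := by
  intro n
  refine Nat.strong_induction_on n ?_
  intro n ih S hS htri
  rcases Nat.eq_zero_or_pos n with hn0 | hn0
  · rw [card_roots_eq_zero_of_size_zero hn0]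
    exact Nat.zero_le _
  by_cases hex : ∃ i j : Fin n, (j : ℕ) = i + 1 ∧ ∀ l, S l i j = 0
  · -- reducible: split at the absent link `(i, j)`, `t = j`
    obtain ⟨i, j, hj, habs⟩ := hex
    have ht : (j : ℕ) ≤ n := j.2.le
    have hlink : ∀ l (i₂ j₂ : Fin n), (j₂ : ℕ) + 1 = (j : ℕ) → (i₂ : ℕ) = (j : ℕ) → S l i₂ j₂ = 0 := by
      intro l i₂ j₂ hj₂ hi₂
      have e₁ : i₂ = j := Fin.ext hi₂
      have e₂ : j₂ = i := Fin.ext (by omega)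
      rw [e₁, e₂, (hS l).apply i j]
      exact habs l
    have hcut := cut_of_absentLink S htri hlink
    refine (card_roots_split d S ht hcut).trans ?_
    have htop := ih (j : ℕ) j.2 _ (symm_top hS ht) (tridiagonal_top htri ht)
    have hbot := ih (n - (j : ℕ)) (by omega) _ (symm_bot hS ht) (tridiagonal_bot htri ht)
    have hsum : (j : ℕ) * 2 ^ (C₀ * (K + Nat.log 2 n ^ 2)) + (n - (j : ℕ)) * 2 ^ (C₀ * (K + Nat.log 2 n ^ 2)) =
        n * 2 ^ (C₀ * (K + Nat.log 2 n ^ 2)) := by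
      rw [← Nat.add_mul, Nat.add_sub_of_le ht]
    calc _ ≤ (j : ℕ) * 2 ^ (C₀ * (K + Nat.log 2 n ^ 2)) + (n - (j : ℕ)) * 2 ^ (C₀ * (K + Nat.log 2 n ^ 2)) :=
          Nat.add_le_add (htop.trans (Nat.mul_le_mul_left _ (sectorBound_mono C₀ K ht)))
            (hbot.trans (Nat.mul_le_mul_left _ (sectorBound_mono C₀ K (Nat.sub_le n j))))
      _ = _ := hsum
  · -- irreducible
    push Not at hex
    calc _ ≤ 2 ^ (C₀ * (K + Nat.log 2 n ^ 2)) := hirr n S hS htri fun i j hj => hex i j hj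
      _ ≤ n * 2 ^ (C₀ * (K + Nat.log 2 n ^ 2)) := Nat.le_mul_of_pos_left _ hn0

/-- **`stub_tridiagonalSectorB` FROM ITS IRREDUCIBLE RESTRICTION** (conclusion = the registered stub's statement verbatim; constant
`C ↦ C + 2`, the factor `m ≤ 2^(2⌊log₂ m⌋²)` being absorbed). [folklore] -/
theorem tridiagonalSectorB_of_irreducible
    (h : ∃ C : ℕ, ∀ (m K : ℕ) (d : Fin K → ℕ) (S : Fin K → Matrix (Fin m) (Fin m) ℝ), (∀ l, (S l).IsSymm) →
      (∀ l (i j : Fin m), (i : ℕ) + 1 < j ∨ (j : ℕ) + 1 < i → S l i j = 0) →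
      (∀ i j : Fin m, (j : ℕ) = i + 1 → ∃ l, S l i j ≠ 0) →
      (Matrix.det (∑ l, ((Polynomial.X : Polynomial ℝ) ^ d l) • (S l).map Polynomial.C)).roots.toFinset.card ≤
        2 ^ (C * (K + Nat.log 2 m ^ 2))) :
    ∃ C : ℕ, ∀ (m K : ℕ) (d : Fin K → ℕ) (S : Fin K → Matrix (Fin m) (Fin m) ℝ), (∀ l, (S l).IsSymm) →
      (∀ l (i j : Fin m), (i : ℕ) + 1 < j ∨ (j : ℕ) + 1 < i → S l i j = 0) →
      (Matrix.det (∑ l, ((Polynomial.X : Polynomial ℝ) ^ d l) • (S l).map Polynomial.C)).roots.toFinset.card ≤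
        2 ^ (C * (K + Nat.log 2 m ^ 2)) := by
  obtain ⟨C, hC⟩ := h
  refine ⟨C + 2, fun m K d S hS htri => ?_⟩
  have hmul := card_roots_le_mul_of_irreducible C d (fun n S' hS' htri' hirr' => hC n K d S' hS' htri' hirr') m S hS htri
  refine hmul.trans ?_
  have h1 : m ≤ 2 ^ (2 * Nat.log 2 m ^ 2) := self_le_two_pow_two_mul_log_sq m
  have hexp : 2 * Nat.log 2 m ^ 2 + C * (K + Nat.log 2 m ^ 2) ≤ (C + 2) * (K + Nat.log 2 m ^ 2) := by
    have e : (C + 2) * (K + Nat.log 2 m ^ 2) = C * (K + Nat.log 2 m ^ 2) + 2 * K + 2 * Nat.log 2 m ^ 2 := by ring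
    rw [e]
    omega
  calc m * 2 ^ (C * (K + Nat.log 2 m ^ 2)) ≤ 2 ^ (2 * Nat.log 2 m ^ 2) * 2 ^ (C * (K + Nat.log 2 m ^ 2)) :=
        Nat.mul_le_mul_right _ h1
    _ = 2 ^ (2 * Nat.log 2 m ^ 2 + C * (K + Nat.log 2 m ^ 2)) := (pow_add _ _ _).symm
    _ ≤ 2 ^ ((C + 2) * (K + Nat.log 2 m ^ 2)) := Nat.pow_le_pow_right two_pos hexp

/-- **`stub_tridiagonalSectorB` ⟺ ITS RESTRICTION TO IRREDUCIBLE CHAINS** (left side = the registered stub's statement verbatim). [folklore] -/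
theorem tridiagonalSectorB_iff_irreducible :
    (∃ C : ℕ, ∀ (m K : ℕ) (d : Fin K → ℕ) (S : Fin K → Matrix (Fin m) (Fin m) ℝ), (∀ l, (S l).IsSymm) →
      (∀ l (i j : Fin m), (i : ℕ) + 1 < j ∨ (j : ℕ) + 1 < i → S l i j = 0) →
      (Matrix.det (∑ l, ((Polynomial.X : Polynomial ℝ) ^ d l) • (S l).map Polynomial.C)).roots.toFinset.card ≤
        2 ^ (C * (K + Nat.log 2 m ^ 2))) ↔
    (∃ C : ℕ, ∀ (m K : ℕ) (d : Fin K → ℕ) (S : Fin K → Matrix (Fin m) (Fin m) ℝ), (∀ l, (S l).IsSymm) →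
      (∀ l (i j : Fin m), (i : ℕ) + 1 < j ∨ (j : ℕ) + 1 < i → S l i j = 0) →
      (∀ i j : Fin m, (j : ℕ) = i + 1 → ∃ l, S l i j ≠ 0) →
      (Matrix.det (∑ l, ((Polynomial.X : Polynomial ℝ) ^ d l) • (S l).map Polynomial.C)).roots.toFinset.card ≤
        2 ^ (C * (K + Nat.log 2 m ^ 2))) :=
  ⟨fun ⟨C, hC⟩ => ⟨C, fun m K d S hS htri _ => hC m K d S hS htri⟩, tridiagonalSectorB_of_irreducible⟩


/-! ## 4. Appendix (same seat, same day): how long is «long» — blocks of length `≤ c·(K + ⌊log₂ m⌋²)` are still harmless -/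

/-- **`stub_tridiagonalSectorB` UNLESS SOME IRREDUCIBLE BLOCK IS LONGER THAN `c·(K + ⌊log₂ m⌋²)`** (constant `C = c + 3`, all
formats): if among any `c·(K + ⌊log₂ m⌋²)` consecutive links of a symmetric tridiagonal family one is absent, the pencil has at most
`2^((c+3)(K + ⌊log₂ m⌋²))` distinct real zeros (`m · 2^(r + K) ≤ 2^(2⌊log₂ m⌋² + r + K)` with `r = c(K + ⌊log₂ m⌋²)`).  So the stub has
content only for chains whose irreducible blocks are longer than every fixed multiple of `K + log₂² m` — in the window, longer than
`≍ K`. [folklore] -/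
theorem sectorB_of_blocksLength_le (c m K : ℕ) (d : Fin K → ℕ) (S : Fin K → Matrix (Fin m) (Fin m) ℝ)
    (hS : ∀ l, (S l).IsSymm) (htri : ∀ l (i j : Fin m), (i : ℕ) + 1 < j ∨ (j : ℕ) + 1 < i → S l i j = 0)
    (hshort : ∀ i : Fin m, (i : ℕ) + c * (K + Nat.log 2 m ^ 2) < m → ∃ j : Fin m, (i : ℕ) ≤ j ∧
      (j : ℕ) < i + c * (K + Nat.log 2 m ^ 2) ∧ ∀ l (j' : Fin m), (j' : ℕ) = j + 1 → S l j j' = 0) :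
    (Matrix.det (∑ l, ((Polynomial.X : Polynomial ℝ) ^ d l) • (S l).map Polynomial.C)).roots.toFinset.card ≤
      2 ^ ((c + 3) * (K + Nat.log 2 m ^ 2)) := by
  refine (card_roots_le_of_shortChains (c * (K + Nat.log 2 m ^ 2)) d m S hS htri hshort).trans ?_
  have h1 : m ≤ 2 ^ (2 * Nat.log 2 m ^ 2) := self_le_two_pow_two_mul_log_sq m
  have hexp : 2 * Nat.log 2 m ^ 2 + (c * (K + Nat.log 2 m ^ 2) + K) ≤ (c + 3) * (K + Nat.log 2 m ^ 2) := by
    have e : (c + 3) * (K + Nat.log 2 m ^ 2) = c * (K + Nat.log 2 m ^ 2) + 3 * K + 3 * Nat.log 2 m ^ 2 := by ring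
    rw [e]
    omega
  calc m * 2 ^ (c * (K + Nat.log 2 m ^ 2) + K)
      ≤ 2 ^ (2 * Nat.log 2 m ^ 2) * 2 ^ (c * (K + Nat.log 2 m ^ 2) + K) := Nat.mul_le_mul_right _ h1
    _ = 2 ^ (2 * Nat.log 2 m ^ 2 + (c * (K + Nat.log 2 m ^ 2) + K)) := (pow_add _ _ _).symm
    _ ≤ 2 ^ ((c + 3) * (K + Nat.log 2 m ^ 2)) := Nat.pow_le_pow_right two_pos hexp


/-- **`stub_tridiagonalSectorBDiag` FROM THE IRREDUCIBLE RESTRICTION** (conclusion = the registered diagonal-family stub verbatim,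
`(m, K) = (2^s, s²)`, constant `2(C+2)`): the uniform irreducible hypothesis gives the uniform stub (`tridiagonalSectorB_of_irreducible`)
and `⌊log₂ 2^s⌋ = s` (as in the skeleton's `tridiagonalSectorBDiag_of_tridiagonalSectorB`). [folklore] -/
theorem tridiagonalSectorBDiag_of_irreducible
    (h : ∃ C : ℕ, ∀ (m K : ℕ) (d : Fin K → ℕ) (S : Fin K → Matrix (Fin m) (Fin m) ℝ), (∀ l, (S l).IsSymm) →
      (∀ l (i j : Fin m), (i : ℕ) + 1 < j ∨ (j : ℕ) + 1 < i → S l i j = 0) →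
      (∀ i j : Fin m, (j : ℕ) = i + 1 → ∃ l, S l i j ≠ 0) →
      (Matrix.det (∑ l, ((Polynomial.X : Polynomial ℝ) ^ d l) • (S l).map Polynomial.C)).roots.toFinset.card ≤
        2 ^ (C * (K + Nat.log 2 m ^ 2))) :
    ∃ C : ℕ, ∀ (s : ℕ) (d : Fin (s ^ 2) → ℕ) (S : Fin (s ^ 2) → Matrix (Fin (2 ^ s)) (Fin (2 ^ s)) ℝ), (∀ l, (S l).IsSymm) →
      (∀ l (i j : Fin (2 ^ s)), (i : ℕ) + 1 < j ∨ (j : ℕ) + 1 < i → S l i j = 0) →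
      (Matrix.det (∑ l, ((Polynomial.X : Polynomial ℝ) ^ d l) • (S l).map Polynomial.C)).roots.toFinset.card ≤
        2 ^ (C * s ^ 2) := by
  obtain ⟨C, hC⟩ := tridiagonalSectorB_of_irreducible h
  refine ⟨2 * C, fun s d S hS hT => (hC (2 ^ s) (s ^ 2) d S hS hT).trans (Nat.pow_le_pow_right two_pos ?_)⟩
  rw [Nat.log_pow one_lt_two s]
  nlinarith [Nat.zero_le C, Nat.zero_le s]

end Summit.ValiantsHypothesis.ValiantsHypothesis.Theorems.KPlusLogSqLaw.TridiagonalSplitting
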